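import Mathlib
import Summits.ResolutionOfSingularities.ResolutionOfSingularities.Theorems.RadicialJungCleanModelsCleanLU3ArcTower
import Summits.ResolutionOfSingularities.ResolutionOfSingularities.Theorems.RadicialJungCleanModelsCleanLU3ArcRep
import Summits.ResolutionOfSingularities.ResolutionOfSingularities.Theorems.RadicialJungCleanModelsCleanLU3ArcTools
import Summits.ResolutionOfSingularities.ResolutionOfSingularities.Theorems.RadicialJungCleanModelsCleanLU3ArcDischarge
import HarnessLib

/-!
# Route `RadicialJung`, crux `CleanModels` (stmt-15917), stub `stub_cleanLU3DefectArcInfinite`: preliminaries for the core —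
# constant-coefficient polynomials in `π` have high order when they have high value; transport of derivations in the `π`-chart;
# powers of `𝔪` grow along the sequence; exchange into a regular system of parameters

Line `Sketch` rev 20 of crux stmt-ResolutionOfSingularities-15917; lead `res-B-lead-1` g3.  OURS; nothing here proves resolution in
characteristic `p`.
-/

noncomputable section

set_option linter.dupNamespace false -- mandated namespace of this single-conjunct summit

open IsLocalRing Polynomial
open Literature.AlgebraicGeometry.Resolution

namespace Summit.ResolutionOfSingularities.ResolutionOfSingularities.Theorems.RadicialJung.CleanModels

variable {K : Type} [Field K]

/-- **K1 for polynomials.** In a local subring `R ⊆ O` dominated by `O` with `π ∈ 𝔪_R` a value-generator, a polynomial in `π` whose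
coefficients are `Q = p^s`-th powers of elements of `R`, of value `≤ v π ^ n` with `n ≤ Q`, lies in `𝔪_R^n`. [folklore] -/
theorem aeval_mem_pow_of_valuation_le {O : ValuationSubring K} {p : ℕ} [Fact p.Prime] [CharP K p] {R : Subring K} [IsLocalRing R]
    (hdom : SubringDominates R O.toSubring) (π : K) (hπR : π ∈ R) (hπ0 : π ≠ 0) (hvπ : O.valuation π < 1)
    (hπ : ∀ x : K, O.valuation x < 1 → O.valuation x ≤ O.valuation π) (s : ℕ)
    (P : Polynomial (R.map (iterateFrobenius K p s))) (n : ℕ) (hn : n ≤ p ^ s)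
    (hv : O.valuation (aeval π P) ≤ O.valuation π ^ n) (hmem : aeval π P ∈ R) :
    (⟨aeval π P, hmem⟩ : R) ∈ maximalIdeal R ^ n := by
  classical
  have hTR : R.map (iterateFrobenius K p s) ≤ R := map_iterateFrobenius_le R s
  let γ : ℕ → R := fun i => ⟨((P.coeff i : R.map (iterateFrobenius K p s)) : K), hTR (P.coeff i).2⟩
  have hγ : ∀ i ∈ Finset.range (P.natDegree + 1), ∃ r : R, γ i = r ^ p ^ s := fun i _ => by
    obtain ⟨r, hr, hri⟩ := (mem_map_iterateFrobenius_iff R s _).mp (P.coeff i).2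
    exact ⟨⟨r, hr⟩, Subtype.ext hri.symm⟩
  have hsum : (⟨aeval π P, hmem⟩ : R) = ∑ i ∈ Finset.range (P.natDegree + 1), γ i * (⟨π, hπR⟩ : R) ^ i := by
    apply Subtype.ext
    rw [AddSubmonoidClass.coe_finsetSum]
    simp only [Subring.coe_mul, Subring.coe_pow]
    rw [aeval_eq_sum_range]
    exact Finset.sum_congr rfl fun i _ => by rw [Algebra.smul_def]; rfl
  rw [hsum]
  refine mem_pow_of_qconst_sum hdom ⟨π, hπR⟩ hπ0 hvπ hπ s _ γ hγ n hn ?_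
  rw [← hsum]; exact hv

/-- **Transport of a derivation in the `π`-chart.** If `E` preserves `R₀`, then `πⁱ • E` preserves `Rᵢ` along a quadratic sequence all of
whose steps are `π`-charts. [folklore] -/
theorem pow_mul_derivation_mem {O : ValuationSubring K} (R : ℕ → Subring K) [hR : ∀ i, IsLocalRing (R i)]
    (h0 : SubringDominates (R 0) O.toSubring) (hstep : ∀ i, IsQuadraticTransformAlong O (R i) (R (i + 1)))
    (π : K) (hπR : π ∈ R 0) (hπ0 : π ≠ 0) (hvπ : O.valuation π < 1)
    (hπ : ∀ x : K, O.valuation x < 1 → O.valuation x ≤ O.valuation π)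
    (E : Derivation ℤ K K) (hE : ∀ y ∈ R 0, E y ∈ R 0) :
    ∀ (i : ℕ) (y : K), y ∈ R i → π ^ i * E y ∈ R i := by
  intro i
  induction i with
  | zero => intro y hy; rw [pow_zero, one_mul]; exact hE y hy
  | succ i ih =>
    intro y hy
    obtain ⟨hπi, hRi⟩ := succ_eq_locAtCentre_blowupRing R h0 hstep π hπR hπ0 hvπ hπ i
    let Ei : Derivation ℤ K K := (π ^ i) • E
    have hEi : ∀ z, Ei z = π ^ i * E z := fun z => by simp [Ei, smul_eq_mul]
    have hEiR : ∀ z ∈ R i, Ei z ∈ R i := fun z hz => by rw [hEi]; exact ih z hz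
    have hB := mul_derivation_mem_blowupRing Ei hEiR hπi hπ0
    have hL := mul_derivation_mem_locAtCentre Ei π (B := blowupRing (R i) π) (O := O) hB
    rw [hRi] at hy
    have := hL y hy
    rw [hEi, ← mul_assoc, ← pow_succ'] at this
    rw [hRi]; exact this

/-- Along the sequence, `𝔪ᵢ^n ⊆ 𝔪_{i'}^n` for `i ≤ i'` (every member is dominated by `O`). [folklore] -/
theorem mem_pow_of_le {O : ValuationSubring K} (R : ℕ → Subring K) [hR : ∀ i, IsLocalRing (R i)]
    (h0 : SubringDominates (R 0) O.toSubring) (hstep : ∀ i, IsQuadraticTransformAlong O (R i) (R (i + 1)))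
    {i i' : ℕ} (hii' : i ≤ i') (n : ℕ) (m : R i) (hm : m ∈ maximalIdeal (R i) ^ n) :
    (⟨(m : K), sequence_monotone hstep hii' m.2⟩ : R i') ∈ maximalIdeal (R i') ^ n := by
  have hle : R i ≤ R i' := sequence_monotone hstep hii'
  have hdom : SubringDominates (R i) O.toSubring := (sequence_dominates h0 hstep i).1
  have hdom' : SubringDominates (R i') O.toSubring := (sequence_dominates h0 hstep i').1
  let ι : R i →+* R i' := Subring.inclusion hle
  have hmap : (maximalIdeal (R i)).map ι ≤ maximalIdeal (R i') := by
    rw [Ideal.map_le_iff_le_comap]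
    intro x hx
    rw [Ideal.mem_comap]
    have hvx : O.valuation (x : K) < 1 := ((subringDominates_valuationSubring_iff hdom.1).mp hdom x).mp hx
    exact ((subringDominates_valuationSubring_iff hdom'.1).mp hdom' (ι x)).mpr hvx
  have h1 : ι m ∈ (maximalIdeal (R i) ^ n).map ι := Ideal.mem_map_of_mem _ hm
  rw [Ideal.map_pow] at h1
  exact Ideal.pow_right_mono hmap n h1

/-- A unit minus an element of the maximal ideal is a unit. [folklore] -/
theorem isUnit_sub_of_mem_maximalIdeal {S : Type*} [CommRing S] [IsLocalRing S] (u m : S) (hu : IsUnit u)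
    (hm : m ∈ maximalIdeal S) : IsUnit (u - m) := by
  by_contra hnu
  have h1 : u - m ∈ maximalIdeal S := (mem_maximalIdeal _).mpr (mem_nonunits_iff.mpr hnu)
  have h2 : u ∈ maximalIdeal S := by
    have : u = (u - m) + m := by ring
    rw [this]; exact Ideal.add_mem _ h1 hm
  exact (mem_maximalIdeal _ |>.mp h2) hu

/-- **Exchange into a regular system of parameters.** In a regular local ring `S` of dimension `3` with `π ∈ 𝔪 ∖ 𝔪²` and
`f ∈ 𝔪 ∖ ((π) + 𝔪²)`, there is `t₃` with `𝔪 = (π, f, t₃)`. [folklore] -/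
theorem exists_span_eq_of_not_mem {S : Type*} [CommRing S] [IsRegularLocalRing S] (hdim : ringKrullDim S = 3) (π f : S)
    (hπm : π ∈ maximalIdeal S) (hπ2 : π ∉ maximalIdeal S ^ 2) (hfm : f ∈ maximalIdeal S)
    (hf : ∀ (a : S), ∀ m₂ ∈ maximalIdeal S ^ 2, f ≠ a * π + m₂) :
    ∃ t₃ : S, maximalIdeal S = Ideal.span {π, f, t₃} := by
  classical
  obtain ⟨x, hx⟩ := exists_regularSystemOfParameters (R := S)
  have hsf : (maximalIdeal S).spanFinrank = 3 := by
    have e := IsRegularLocalRing.spanFinrank_maximalIdeal (R := S)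
    rw [hdim] at e; exact_mod_cast e
  let x' : Fin 3 → S := fun j => x (Fin.cast hsf.symm j)
  have hx' : maximalIdeal S = Ideal.span {x' 0, x' 1, x' 2} := by
    rw [← hx]
    have hr : Set.range x = Set.range x' := by
      ext t
      simp only [Set.mem_range, x']
      constructor
      · rintro ⟨i, rfl⟩; exact ⟨Fin.cast hsf i, by simp⟩
      · rintro ⟨j, rfl⟩; exact ⟨Fin.cast hsf.symm j, rfl⟩
    rw [hr]
    congr 1
    ext t
    simp only [Set.mem_range, Set.mem_insert_iff, Set.mem_singleton_iff]
    constructor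
    · rintro ⟨i, rfl⟩; fin_cases i <;> simp
    · rintro (rfl | rfl | rfl)
      exacts [⟨0, rfl⟩, ⟨1, rfl⟩, ⟨2, rfl⟩]
  obtain ⟨y, z, hym, hzm, hmyz⟩ := exists_span_triple_of_not_mem_sq (x' 0) (x' 1) (x' 2) π hx' hπm hπ2
  rw [hmyz] at hfm
  obtain ⟨a₀, a₁, a₂, hfeq⟩ := (mem_span_triple_iff π y z f).mp hfm
  by_cases h₁ : IsUnit a₁
  · refine ⟨z, ?_⟩
    have := span_triple_exchange y π z f a₁ a₀ a₂ (by rw [hmyz, Set.insert_comm]) (by rw [hfeq]; ring) h₁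
    rw [this, Set.insert_comm]
  by_cases h₂ : IsUnit a₂
  · refine ⟨y, ?_⟩
    have e3 : ({π, y, z} : Set S) = {z, π, y} := by
      ext t; simp only [Set.mem_insert_iff, Set.mem_singleton_iff]; tauto
    have := span_triple_exchange z π y f a₂ a₀ a₁ (by rw [hmyz, e3]) (by rw [hfeq]; ring) h₂
    rw [this, Set.insert_comm]
  exfalso
  have hm₁ : a₁ ∈ maximalIdeal S := (mem_maximalIdeal _).mpr (mem_nonunits_iff.mpr h₁)
  have hm₂ : a₂ ∈ maximalIdeal S := (mem_maximalIdeal _).mpr (mem_nonunits_iff.mpr h₂)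
  refine hf a₀ (a₁ * y + a₂ * z) ?_ (by rw [hfeq, add_assoc])
  rw [pow_two]
  exact Ideal.add_mem _ (Ideal.mul_mem_mul hm₁ hym) (Ideal.mul_mem_mul hm₂ hzm)

end Summit.ResolutionOfSingularities.ResolutionOfSingularities.Theorems.RadicialJung.CleanModels

end
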